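import Summits.QuantumFields.BalabanUV.Beta.GAN24.CombBornLambdaLineage
import Summits.QuantumFields.BalabanUV.Beta.GAN24.KSlotAssembly
import Summits.QuantumFields.BalabanUV.Beta.GAN24.StencilSlotCauchyOfShapes

/-!
# The fresh Λ-source of the comb-chart remainder DRIFTS GEOMETRICALLY in the birth level — the first per-lineage letter of the (III′) Λ-born RATE row,
# UNCONDITIONALLY at `d = 3` (`2 ≤ Lc`)

NOT IN PRINT — OUR BOOKKEEPING (road-P2 = `b2b-balaban-gan24-p2` gen 56, 2026-08-25; row G-an2-4 ∕ (CONV-C), the (α-0) chain at row D1's literal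
OF RECORD (III′) `JsB12CombShSym`; [folklore] composition BY NAME; 0 `def`, 0 cite, 0 `def … : Prop`, 0 `sorry`).  Weight 0.  NEVER «G-an2-4 closed» as (CONV-C);
NOT D1, NOT BetaPertH, NOT continuum, NOT Clay; NO campaign opened (an2 W-4).

This is the (III′) twin of leaf-03 g40's `StencilSlotLamDriftRoot.locStencil_unitS_lamPiece_sub` and of leaf-06 g41's `BornLambdaDrift.exists_hXd_lam_of_K ∕ exists_hXd_lam_three`
for the Λ-source `combFreshAt tabs 0 cΛ` at the sym Hessian table `tabs.H` of ANY `tabs : SymTables d Lc` (ff-valued, `hHff` displayed), over M.58 `CombBornLambdaLineage`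
(`unitS_combFreshAt_lam_succ`: member `j+1` in units is `(cΛ·Lc^{2(d+1)}) • SLam Lc (lamCoeffK (KStepUnit Lc (j+1)) ((smStep d Lc j)² • E2 d Lc (j+1)) Lc) tabs.H`; `exists_hX_lam_three`):
* §1 **`locStencil_unitS_combFreshAt_lam_sub (hHff) (hK hKall hδ hθ) (hQ) (cΛ k j)`** — the difference of the Λ-sources of members `k+j+1` and `k+1` in their own units is a
  local stencil family at rate `δ∕4` with constant `CΛdrift·θ^k`, `CΛdrift = |cΛ·Lc^{2(d+1)}|·((d+1)·((|Fib d|·(cK·θ·C + C·cK)·Zl(δ−δ∕2))·CH·Zl(δ∕4)))` — leaf-03's proof token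
  for token with the record's (LH) `hQ : VertexFamily tabs.H Lc CH (δ∕2)` for an1's `biLoc_hessFFAt` (the K-slot data `UnitDecayK ∕ CauchyDecayK` as hypotheses; leaf-03 g39's
  `StencilSlotLamDrift.SLam_sub ∕ abs_lamCoeff_sub_le`, an2's `locStencil_SLam` BY NAME).
* §2 **`exists_hXd_lam_of_K`** (generic `d`; members `≥ 1` by §1 with `j = 1` under (LH) at `δ∕2`, the pair `(1,0)` by M.58's `hX` twice; `θF = max θ ½`) and
  **`exists_hXd_lam_three (tabs : SymTables 3 Lc) (hHff) (hLc : 2 ≤ Lc) (cΛ)`** — UNCONDITIONAL: road P1's `KSlotAssembly.convCKWall_holds` + M.58 `exists_hX_lam_three`: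
  `∃ CF θF δF, 0 ≤ CF ∧ 0 ≤ θF ∧ θF < 1 ∧ 0 < δF ∧ ∀ k, LocStencil (unitS_{k+1} (combFreshAt tabs 0 cΛ (k+1)) − unitS_k (combFreshAt tabs 0 cΛ k)) (CF·θF^k) δF`
  = the letter `hXd` of M.62 `CombBornDriftSockets.exists_hBdevLam_of_letters` VERBATIM — THE FIRST OF THE FIVE PER-LINEAGE RATE LETTERS OF THE (III′) BORN ROW, DISCHARGED.
The other four (`hT-Λ`, `hP-Λ`, `hT-V`, `hP-V`) and the four ROW letters are NOT typed (located in road-P2's INTENT-9…12).  NO value ∕ rate of Bałaban's tables asserted: the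
rate `θ` is road P1's PROVED Cauchy rate of the unit-normalised step resolvents (`FibreRate.realRateK`), whatever it is.
-/

noncomputable section

open Finset
open scoped BigOperators
open Literature.MathematicalPhysics.QuantumFieldTheory
open Literature.MathematicalPhysics.QuantumFieldTheory.Balaban1983to89
open Literature.MathematicalPhysics.QuantumFieldTheory.Balaban1983to89.Beta
open B12Sec2to5 (l1 l1_nonneg)
open ExpKernelCalculus (MKer Decays VertexFamily Zl Zl_nonneg)
open OneStepResolventKernel (Fib LocStencil)
open OneStepKernelFamily (KInvStep)
open InterLevelTransport (SLam locStencil_SLam)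
open BalabanStepJetsSucc (wΛ E2 lamCoeffK abs_lamCoeffK_le)
open Summit.QuantumFields.BalabanUV.Beta.GAN24.StencilSlotCauchyOfShapes (locStencil_sub)
open Summit.QuantumFields.BalabanUV.Beta.HessKerDressedUnits (unitS)
open Summit.QuantumFields.BalabanUV.Beta.SymmetrisedStepJets (SymTables)
open Summit.QuantumFields.BalabanUV.Beta.GAN24.CombesThomas (sfStep smStep KStepUnit UnitDecayK CauchyDecayK)
open Summit.QuantumFields.BalabanUV.Beta.GAN24.StencilSlotOfShapes (locStencil_mono')
open Summit.QuantumFields.BalabanUV.Beta.GAN24.StencilSlotLam (decays_E2unit)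
open Summit.QuantumFields.BalabanUV.Beta.GAN24.StencilSlotLamDrift (SLam_sub abs_lamCoeff_sub_le)
open Summit.QuantumFields.BalabanUV.Beta.GAN24.Push4 (IsFF)
open Summit.QuantumFields.BalabanUV.Beta.GAN24.KSlotAssembly (convCKWall_holds)
open Summit.QuantumFields.BalabanUV.Beta.GAN24.CombBornSector (combFreshAt)
open Summit.QuantumFields.BalabanUV.Beta.GAN24.CombBornLambdaLineage (unitS_combFreshAt_lam_succ exists_hX_lam_three)

namespace Summit.QuantumFields.BalabanUV.Beta.GAN24.CombBornLambdaFreshDrift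

variable {d : ℕ} {Lc : ℕ} [NeZero Lc] (tabs : SymTables d Lc) (hHff : ∀ μ y, IsFF (tabs.H μ y))
include hHff

/-! ## §1 The drift of the Λ-source in units between members `k+j+1` and `k+1` -/

/-- NOT IN PRINT; OUR BOOKKEEPING ([folklore]; leaf-03 g40's `StencilSlotLamDriftRoot.locStencil_unitS_lamPiece_sub` RE-RUN on the sym Hessian table).  **THE Λ-SOURCE DRIFTS
GEOMETRICALLY**: from the K-slot data `UnitDecayK … C δ` ∕ `CauchyDecayK … cK θ δ` (`0 < δ`, `0 ≤ θ`) and the record's (LH) `hQ : VertexFamily tabs.H Lc CH (δ∕2)`, the difference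
of the Λ-sources of members `k+j+1` and `k+1` of the comb-chart remainder in their own units is a local stencil family at rate `δ∕4` with constant `CΛdrift·θ^k`,
`CΛdrift = |cΛ·Lc^{2(d+1)}|·((d+1)·((|Fib d|·(cK·θ·C + C·cK)·Zl(δ−δ∕2))·CH·Zl(δ∕4)))` (`k, j`-free). -/
theorem locStencil_unitS_combFreshAt_lam_sub {C cK θ δ CH : ℝ} (hK : UnitDecayK d Lc (sfStep Lc) (smStep d Lc) C δ)
    (hKall : CauchyDecayK d Lc (sfStep Lc) (smStep d Lc) cK θ δ) (hδ : 0 < δ) (hθ : 0 ≤ θ) (hQ : VertexFamily tabs.H Lc CH (δ / 2)) (cΛ : ℝ) (k j : ℕ) :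
    LocStencil
      (unitS (sfStep Lc (k + j + 1)) (smStep d Lc (k + j + 1)) (combFreshAt tabs 0 cΛ (k + j + 1))
        - unitS (sfStep Lc (k + 1)) (smStep d Lc (k + 1)) (combFreshAt tabs 0 cΛ (k + 1)))
      ((|cΛ * (Lc : ℝ) ^ (2 * (d + 1))| *
          ((d + 1 : ℕ) * (((Fintype.card (Fib d) : ℝ) * (cK * θ * C + C * cK) * Zl (d + 1) (δ - δ / 2)) * CH * Zl (d + 1) (δ / 2 / 2)))) * θ ^ k)
      (δ / 2 / 2) := by
  rw [unitS_combFreshAt_lam_succ tabs hHff cΛ (k + j), unitS_combFreshAt_lam_succ tabs hHff cΛ k]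
  -- data
  have hC : 0 ≤ C := (hK 0).nonneg (Sum.inl 0)
  have hcK : 0 ≤ cK := by
    have h := (hKall 0 0).nonneg (Sum.inl 0)
    simpa using h
  -- the two coefficient families and their difference
  set c₁ := lamCoeffK (KStepUnit (d := d) Lc (k + j + 1)) ((smStep d Lc (k + j)) ^ 2 • E2 d Lc (k + j + 1)) Lc with hc₁def
  set c₂ := lamCoeffK (KStepUnit (d := d) Lc (k + 1)) ((smStep d Lc k) ^ 2 • E2 d Lc (k + 1)) Lc with hc₂def
  have hZ : 0 ≤ Zl (d + 1) (δ - δ / 2) := Zl_nonneg (by linarith)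
  have hc₁ : ∀ μ y κ u, |c₁ μ y κ u| ≤ ((Fintype.card (Fib d) : ℝ) * (C * C) * Zl (d + 1) (δ - δ / 2)) *
      Real.exp (-(δ / 2) * l1 ((Lc : ℤ) • y - u)) :=
    abs_lamCoeffK_le (hK (k + j + 1)) (decays_E2unit (hK (k + j)) hδ.le) hδ Lc
  have hc₂ : ∀ μ y κ u, |c₂ μ y κ u| ≤ ((Fintype.card (Fib d) : ℝ) * (C * C) * Zl (d + 1) (δ - δ / 2)) *
      Real.exp (-(δ / 2) * l1 ((Lc : ℤ) • y - u)) :=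
    abs_lamCoeffK_le (hK (k + 1)) (decays_E2unit (hK k) hδ.le) hδ Lc
  have hCC : 0 ≤ (Fintype.card (Fib d) : ℝ) * (C * C) * Zl (d + 1) (δ - δ / 2) := by positivity
  -- the drift bound on the coefficients, with θ^(k+1) + θ^k folded in
  set Cd : ℝ := ((Fintype.card (Fib d) : ℝ) * (cK * θ * C + C * cK) * Zl (d + 1) (δ - δ / 2)) * θ ^ k with hCd
  have hCd0 : 0 ≤ Cd := by positivity
  have hdiff : ∀ μ y κ u, |c₁ μ y κ u - c₂ μ y κ u| ≤ Cd * Real.exp (-(δ / 2) * l1 ((Lc : ℤ) • y - u)) := by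
    intro μ y κ u
    refine (abs_lamCoeff_sub_le hK hKall hδ k j μ y κ u).trans (le_of_eq ?_)
    rw [hCd]
    ring
  -- S^Λ of the difference coefficients is a local stencil family
  have hS := locStencil_SLam (N := Lc) (c := fun μ y κ u => c₁ μ y κ u - c₂ μ y κ u) hdiff hQ (by positivity) hCd0
  -- conclude entrywise
  intro κ u x z a b
  have hlin := SLam_sub (N := Lc) hc₁ hc₂ hQ (by positivity) hCC hCC κ u x z a b
  have hb := hS κ u x z a b
  simp only [Pi.sub_apply, Pi.smul_apply, smul_eq_mul]
  rw [← mul_sub, hlin, abs_mul]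
  refine (mul_le_mul_of_nonneg_left hb (abs_nonneg _)).trans (le_of_eq ?_)
  rw [hCd]
  ring

/-! ## §2 The fresh Λ-source drift letter `hXd` of the (III′) Λ-born rate row -/

/-- NOT IN PRINT; OUR BOOKKEEPING (generic `d`; the K-slot data as HYPOTHESES; the (III′) twin of leaf-06's `BornLambdaDrift.exists_hXd_lam_of_K`).  **THE FRESH Λ-SOURCE
OF THE COMB-CHART REMAINDER DRIFTS GEOMETRICALLY IN THE BIRTH LEVEL**: `UnitDecayK … C δ`, `CauchyDecayK … cK θ δ` (`0 < δ`, `0 ≤ θ < 1`) and a level-uniform letter `hX` for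
the Λ-sources in units give `LocStencil (unitS_{k+1} (combFreshAt tabs 0 cΛ (k+1)) − unitS_k (combFreshAt tabs 0 cΛ k)) (CF·θF^k) δF` with ONE `CF`, `θF = max θ ½` — members
`≥ 1` by §1 (`j = 1`, the record's (LH) at `δ∕2`), the pair `(1, 0)` by `hX` twice. -/
theorem exists_hXd_lam_of_K {C cK θ δ : ℝ} (hK : UnitDecayK d Lc (sfStep Lc) (smStep d Lc) C δ)
    (hKall : CauchyDecayK d Lc (sfStep Lc) (smStep d Lc) cK θ δ) (hδ : 0 < δ) (hθ0 : 0 ≤ θ) (hθ1 : θ < 1) (cΛ : ℝ)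
    (hX : ∃ CX δX : ℝ, 0 < δX ∧ ∀ k : ℕ, LocStencil (unitS (sfStep Lc k) (smStep d Lc k) (combFreshAt tabs 0 cΛ k)) CX δX) :
    ∃ CF θF δF : ℝ, 0 ≤ CF ∧ 0 ≤ θF ∧ θF < 1 ∧ 0 < δF ∧ ∀ k : ℕ,
      LocStencil (unitS (sfStep Lc (k + 1)) (smStep d Lc (k + 1)) (combFreshAt tabs 0 cΛ (k + 1))
        - unitS (sfStep Lc k) (smStep d Lc k) (combFreshAt tabs 0 cΛ k)) (CF * θF ^ k) δF := by
  obtain ⟨CX, δX, hδX, hX⟩ := hX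
  obtain ⟨CH, hQ⟩ := tabs.hH (δ / 2) (by positivity)
  set Cd : ℝ := |cΛ * (Lc : ℝ) ^ (2 * (d + 1))| *
      ((d + 1 : ℕ) * (((Fintype.card (Fib d) : ℝ) * (cK * θ * C + C * cK) * Zl (d + 1) (δ - δ / 2)) * CH * Zl (d + 1) (δ / 2 / 2))) with hCd
  have hd : ∀ m : ℕ, LocStencil (unitS (sfStep Lc (m + 1 + 1)) (smStep d Lc (m + 1 + 1)) (combFreshAt tabs 0 cΛ (m + 1 + 1))
      - unitS (sfStep Lc (m + 1)) (smStep d Lc (m + 1)) (combFreshAt tabs 0 cΛ (m + 1))) (Cd * θ ^ m) (δ / 2 / 2) :=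
    fun m => locStencil_unitS_combFreshAt_lam_sub tabs hHff hK hKall hδ hθ0 hQ cΛ m 1
  have hCX : 0 ≤ CX := ((hX 0) 0 0).nonneg (Sum.inl 0)
  have hCd0 : 0 ≤ Cd := by
    have h := ((hd 0) 0 0).nonneg (Sum.inl 0)
    simpa using h
  set θF : ℝ := max θ (1 / 2) with hθF
  have hθF0 : 0 < θF := lt_of_lt_of_le (by norm_num) (le_max_right _ _)
  have hθF1 : θF < 1 := max_lt hθ1 (by norm_num)
  have hθθF : θ ≤ θF := le_max_left _ _
  set δF : ℝ := min δX (δ / 2 / 2) with hδFdef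
  have hδF0 : 0 < δF := lt_min hδX (by positivity)
  refine ⟨max (CX + CX) (Cd / θF), θF, δF, le_max_of_le_left (by positivity), hθF0.le, hθF1, hδF0, fun k => ?_⟩
  cases k with
  | zero =>
      have h := locStencil_sub (hX (0 + 1)) (hX 0)
      rw [pow_zero, mul_one]
      exact locStencil_mono' h (le_max_left _ _) (min_le_left _ _)
  | succ m =>
      -- members (m+2, m+1): the drift `Cd θ^m = (Cd/θF)·θF·θ^m ≤ (Cd/θF)·θF^(m+1)`
      have h := hd m
      have hb : Cd * θ ^ m ≤ max (CX + CX) (Cd / θF) * θF ^ (m + 1) := by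
        calc Cd * θ ^ m ≤ Cd * θF ^ m := mul_le_mul_of_nonneg_left (pow_le_pow_left₀ hθ0 hθθF m) hCd0
          _ = Cd / θF * θF ^ (m + 1) := by rw [pow_succ]; field_simp
          _ ≤ max (CX + CX) (Cd / θF) * θF ^ (m + 1) :=
              mul_le_mul_of_nonneg_right (le_max_right _ _) (pow_nonneg hθF0.le _)
      exact locStencil_mono' h hb (min_le_right _ _)

omit hHff in
/-- NOT IN PRINT; OUR BOOKKEEPING (`d = 3`, `2 ≤ Lc`, UNCONDITIONAL; the (III′) twin of leaf-06's `exists_hXd_lam_three`).  **THE FRESH Λ-SOURCE DRIFT OF THE `d = 3`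
COMB-CHART FAMILY AT THE SYM HESSIAN TABLE**: road P1's `KSlotAssembly.convCKWall_holds` (`hK ∧ hKall` of the unit-normalised step resolvents) and M.58's
`exists_hX_lam_three` discharge `exists_hXd_lam_of_K` — the letter `hXd` of M.62 `CombBornDriftSockets.exists_hBdevLam_of_letters`, verbatim. -/
theorem exists_hXd_lam_three {Lc : ℕ} [NeZero Lc] (tabs : SymTables 3 Lc) (hHff : ∀ μ y, IsFF (tabs.H μ y)) (hLc : 2 ≤ Lc) (cΛ : ℝ) :
    ∃ CF θF δF : ℝ, 0 ≤ CF ∧ 0 ≤ θF ∧ θF < 1 ∧ 0 < δF ∧ ∀ k : ℕ,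
      LocStencil (unitS (sfStep Lc (k + 1)) (smStep 3 Lc (k + 1)) (combFreshAt tabs 0 cΛ (k + 1))
        - unitS (sfStep Lc k) (smStep 3 Lc k) (combFreshAt tabs 0 cΛ k)) (CF * θF ^ k) δF := by
  obtain ⟨C, δ, cK, θ, hδ, hθ0, hθ1, hK, hKall⟩ := convCKWall_holds (Lc := Lc) hLc
  exact exists_hXd_lam_of_K (d := 3) tabs hHff hK hKall hδ hθ0 hθ1 cΛ (exists_hX_lam_three tabs hHff cΛ)

end Summit.QuantumFields.BalabanUV.Beta.GAN24.CombBornLambdaFreshDrift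

end
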